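import Literature.LinearAlgebra.Matrix.PfaffianSamuelson
import Literature.Computability.AlgebraicComplexity.AndrewsForbes2022Prop42AllFields
import HarnessLib

/-!
# A layered algebraic branching program with `O(t³)` vertices for the Pfaffian
# (the [MSV04, Thm. 12] input of Andrews–Forbes 2022, Cor. 4.5) — discharge of
# `AndrewsForbes2022_cor_4_5`

Discharge (D-0014) of the named fact
`Literature.Computability.AlgebraicComplexity.AndrewsForbes2022_cor_4_5` (Andrews–Forbes, STOC 2022,
Cor. 4.5, characteristic-zero bullet; `AndrewsForbes2022DeterminantalIdeals.lean`, cell val-lit t24).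
The tree already reduces Cor. 4.5 to ONE input (`AndrewsForbes2022_cor_4_5_of_pfaffianABP`,
`AndrewsForbes2022Prop42AllFields.lean`): for every field of characteristic zero and every `t ≥ 1`, a
layered algebraic branching program with at most `c·t³` vertices computing the Pfaffian of the
generic `2t × 2t` skew-symmetric matrix — in the printed proof "[MSV04, Thm. 12]", the
Mahajan–Subramanya–Vinay program over pclow sequences. This file supplies that input with `c = 16`
(`layeredABPComputes_pfaffian`, over every commutative ring) and concludes
`AndrewsForbes2022_cor_4_5_holds`.

## The program (§3) and why it is correct (§§1–2)

We do NOT follow the combinatorial (pclow / alternating-clow) route of [MSV04] and Rote 2001 §3.2,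
whose correctness proof is a sign-reversing involution. Instead the program is Rote's INCREMENTAL
algorithm (Rote 2001, §3.3, recursion (23) `P̃_A(λ) = G(λ)·P̃_M(λ)`), realised as a layered graph,
with the ALGEBRAIC correctness proof of `Literature/LinearAlgebra/Matrix/PfaffianSamuelson.lean`
(Pfaffian Cramer rule; Rote §4.1 noted that no algebraic proof of (23) was known to him).

For an alternating `(2t+2) × (2t+2)` matrix `A` let `A_n` be its trailing `n × n` block (`blk`),
`J_n` the standard symplectic form (`stdJ`), `q_n(X) = pf(X·A_n + J_n)` (`q`; `[X^d] q_n` is the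
part of `pf` of degree `d` in the entries), and for the step `n ↦ n+2` let `w, v, u` be the new
corner entry and the two new rows (`wN`, `vN`, `uN`), `K_n = J_n A_n` (`K`). By
`PfaffianSamuelson.coeff_pfaffian_pencil_border₂` (Rote's (23)):
`[X^d] q_{n+2} = [X^d] q_n + w·[X^{d−1}] q_n − Σ_{b ≤ d−2} [X^{d−2−b}] q_n · vᵀ K_n^b J_n u`
(`q_coeff_step`, `q_coeff_step_zero_one`; the tower structure `A_{m+4} = border₂ w v u A_{m+2}` is
`blk_eq_border₂`). The program (`adj` on the vertex type `Vtx t = Fin (t+2) × Fin (t+2) ×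
Option (Option (Fin (2t+2)))`: degree `d`, block index `i`, and a state `⋆ | † | position x < 2i`)
has the edges: skip `⋆_{d,i} → ⋆_{d,i+1}` (label `1`), corner `⋆_{d,i} → †_{d+1,i}` (label `w`),
open `⋆_{d,i} → x'_{d+1,i}` (label `−v_{x'}`), step `x_{d,i} → x'_{d+1,i}` (label `K[x,x']`, a
single signed entry of `A`), close `x_{d,i} → †_{d+1,i}` (label `(J u)_x`), transfer
`†_{d,i} → ⋆_{d,i+1}` (label `1`); every edge raises the layer `d + i` by one
(`layer_eq_of_adj_ne_zero`). The invariant `adj_pow_src` identifies the path sums from the source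
`⋆_{0,0}` with `[X^d] q_{2i}` at `⋆_{d,i}` (and with the walk sums `valPos`/`valDag`, closed forms
`valPos_eq_G`/`valDag_succ`, at the other states); at the sink `⋆_{t+1,t+1}` after `2t+2` layers the
value is the top coefficient `[X^{t+1}] q_{2t+2} = pf A` (`adj_pow_src_snk`,
`PfaffianSamuelson.natDegree_pfaffian_pencil_le_and_coeff`). The vertex count is
`|Vtx t| = 2(t+2)³` (`card_vtx`); re-indexing by `Fin` gives `layeredABPComputes_of_alternating`
(any alternating `A` with affine entries), and for the generic skew matrix `skewX` of size
`2t = 2(t'+1)` the bound `2(t'+2)³ ≤ 16 t³` (`layeredABPComputes_pfaffian`).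

Honest framing: this is a formalisation of a known polynomial-size construction (Pfaffian ∈ VBP with
an explicit cubic vertex count); it closes the literature fact `AndrewsForbes2022_cor_4_5` exactly as
printed and says nothing about VP vs VNP.

## References

* M. Mahajan, P. R. Subramanya, V. Vinay, *The combinatorial approach yields an NC algorithm for
  computing Pfaffians*, Discrete Appl. Math. 143 (2004) 1–16, Theorem 12 (polynomial-size
  branching programs / NC algorithm for the Pfaffian). [MahajanSubramanyaVinay2004]
* G. Rote, *Division-free algorithms for the determinant and the Pfaffian: algebraic and
  combinatorial approaches*, LNCS 2122 (2001) 119–135, §3.3 eqs. (22)–(23) (author's copy read as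
  `paper:url-904784b63cf4`, p0012–p0014). [Rote2001]
* R. Andrews, M. A. Forbes, *Ideals, determinants, and straightening: proving and using lower bounds
  for polynomial ideals*, STOC 2022 = arXiv:2112.00792, Cor. 4.5 (p0028:L63–L74). [AndrewsForbes2022]
-/

noncomputable section

namespace Literature.Computability.AlgebraicComplexity

open Polynomial Finset
open _root_.Matrix
open Literature.LinearAlgebra.Matrix (border₂ pfCof stdJ stdJ_transpose stdJ_apply_self stdJ_eq_border₂
  stdJ_mul_stdJ coeff_pfaffian_pencil_border₂ coeff_pfaffian_pencil_border₂_zero_one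
  natDegree_pfaffian_pencil_le_and_coeff pfaffian_pencil_fin_two)

namespace PfaffianABP

variable {S : Type*} [CommRing S] (t : ℕ) (A : Matrix (Fin (2 * t + 2)) (Fin (2 * t + 2)) S)

/-! ## §1 The trailing blocks of `A` and their bordering data -/

/-- The increasing embedding of the trailing block of size `n` of `Fin (2t+2)`:
`x ↦ 2t + 2 − n + x` (clamped, so that it is defined for every `n`). [folklore] -/
def emb (n : ℕ) (x : ℕ) : Fin (2 * t + 2) := ⟨min (2 * t + 2 - n + x) (2 * t + 1), by omega⟩

/-- The trailing `n × n` block of `A`. [folklore] -/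
def blk (n : ℕ) : Matrix (Fin n) (Fin n) S := A.submatrix (fun x => emb t n x) (fun x => emb t n x)

/-- Row of the first bordering vector for the step `n ↦ n + 2` (index `2t − n`). [folklore] -/
def prow (n : ℕ) : Fin (2 * t + 2) := ⟨min (2 * t - n) (2 * t + 1), by omega⟩

/-- Row of the second bordering vector for the step `n ↦ n + 2` (index `2t − n + 1`). [folklore] -/
def prow' (n : ℕ) : Fin (2 * t + 2) := ⟨min (2 * t - n + 1) (2 * t + 1), by omega⟩

/-- The corner entry `w` of the step `n ↦ n + 2`. [folklore] -/
def wN (n : ℕ) : S := A (prow t n) (prow' t n)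

/-- The first bordering row `v` of the step `n ↦ n + 2`, as a function of the local index. [folklore] -/
def vN (n : ℕ) (x : ℕ) : S := A (prow t n) (emb t n x)

/-- The second bordering row `u` of the step `n ↦ n + 2`. [folklore] -/
def uN (n : ℕ) (x : ℕ) : S := A (prow' t n) (emb t n x)

/-- `v` as a vector on `Fin n`. [folklore] -/
def vS (n : ℕ) : Fin n → S := fun x => vN t A n x

/-- `u` as a vector on `Fin n`. [folklore] -/
def uS (n : ℕ) : Fin n → S := fun x => uN t A n x

/-- The reversed Pfaffian-characteristic polynomial of the trailing block:
`q_n(X) = pf(X · A_n + J_n)`. [cite: Rote2001, §3.3 (definition of P̃_A)] -/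
def q (n : ℕ) : S[X] :=
  Literature.LinearAlgebra.Matrix.pfaffian
    ((X : S[X]) • (blk t A n).map C + (stdJ n : Matrix (Fin n) (Fin n) S).map C)

/-- The transfer matrix `K_n = J_n · A_n` of the walks inside block `n`. [folklore] -/
def K (n : ℕ) : Matrix (Fin n) (Fin n) S := stdJ n * blk t A n

/-- The closed-walk weights `r_{n,b} = vᵀ K_n^b J_n u` (Rote's `r B₀ (M B₀)^b s` up to sign).
[cite: Rote2001, §3.3 (22)] -/
def rS (n b : ℕ) : S := vS t A n ⬝ᵥ ((K t A n ^ b * stdJ n) *ᵥ uS t A n)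

/-- The step label `K_n[x, x']` as a function of local indices (zero out of range). [folklore] -/
def KN (n : ℕ) (x x' : ℕ) : S :=
  if h : x < n ∧ x' < n then K t A n ⟨x, h.1⟩ ⟨x', h.2⟩ else 0

/-- The closing label `(J_n u)[x]` as a function of the local index. [folklore] -/
def cN (n : ℕ) (x : ℕ) : S :=
  if h : x < n then ((stdJ n : Matrix (Fin n) (Fin n) S) *ᵥ uS t A n) ⟨x, h⟩ else 0

/-- The walk sums at the positions of block `n`, defined by the dynamics of the program: start with
`−v_{x'} · q_{n,d}` from the block's `⋆`-state, or continue a walk by one `K_n`-step. [folklore] -/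
def valPos (n : ℕ) : ℕ → ℕ → S
  | 0, _ => 0
  | d + 1, x' => -(vN t A n x') * (q t A n).coeff d +
      ∑ x ∈ Finset.range n, valPos n d x * KN t A n x x'

/-- The walk sums at the `†`-state of block `n`: the corner edge `w · q_{n,d}` plus the closed walks.
[folklore] -/
def valDag (n : ℕ) : ℕ → S
  | 0 => 0
  | d + 1 => wN t A n * (q t A n).coeff d + ∑ x ∈ Finset.range n, valPos t A n d x * cN t A n x

/-- Closed form of the walk sums: `G_{n,d} = −Σ_{b<d} q_{n,d−1−b} · (vᵀ K_n^b)`. [folklore] -/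
def G (n d : ℕ) (x : Fin n) : S :=
  -∑ b ∈ Finset.range d, (q t A n).coeff (d - 1 - b) * (vS t A n ᵥ* K t A n ^ b) x

section Structure

variable {t}

omit [CommRing S] in
/-- The full block is `A`. [folklore] -/
private theorem blk_self : blk t A (2 * t + 2) = A := by
  ext i j
  have hi : emb t (2 * t + 2) i = i := Fin.ext (by simp only [emb]; omega)
  have hj : emb t (2 * t + 2) j = j := Fin.ext (by simp only [emb]; omega)
  simp [blk, hi, hj]

variable {A}

/-- The trailing blocks of an alternating matrix are alternating. [folklore] -/
private theorem blk_transpose (hA : Aᵀ = -A) (n : ℕ) : (blk t A n)ᵀ = -blk t A n := by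
  ext i j
  have := congrFun (congrFun hA (emb t n i)) (emb t n j)
  simpa [blk] using this

/-- The trailing blocks have zero diagonal. [folklore] -/
private theorem blk_apply_self (hd : ∀ i, A i i = 0) (n : ℕ) (i : Fin n) : blk t A n i i = 0 := by
  simp [blk, hd]

/-- **The tower structure of the trailing blocks**: `A_{m+4} = [[0, w, vᵀ], [−w, 0, uᵀ], [−v, −u, A_{m+2}]]`
for an alternating `A` (Rote's partition "splitting two rows and columns", §3.3).
[cite: Rote2001, §3.3 (the partition of A)] -/
theorem blk_eq_border₂ (hA : Aᵀ = -A) (hd : ∀ i, A i i = 0) (m : ℕ) (hm : m + 4 ≤ 2 * t + 2) :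
    blk t A (m + 4) = border₂ (wN t A (m + 2)) (vS t A (m + 2)) (uS t A (m + 2)) (blk t A (m + 2)) := by
  have halt : ∀ a b, A b a = -A a b := fun a b => by
    have := congrFun (congrFun hA a) b; simpa using this
  have he0 : emb t (m + 4) ((0 : Fin (m + 4)) : ℕ) = prow t (m + 2) :=
    Fin.ext (by simp only [emb, prow, Fin.val_zero]; omega)
  have he1 : emb t (m + 4) (((0 : Fin (m + 3)).succ : Fin (m + 4)) : ℕ) = prow' t (m + 2) :=
    Fin.ext (by simp only [emb, prow', Fin.val_succ, Fin.val_zero]; omega)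
  have hess : ∀ k : Fin (m + 2), emb t (m + 4) ((k.succ.succ : Fin (m + 4)) : ℕ) = emb t (m + 2) k :=
    fun k => Fin.ext (by simp only [emb, Fin.val_succ]; omega)
  ext i j
  simp only [blk, submatrix_apply]
  induction i using Fin.cases with
  | zero =>
    induction j using Fin.cases with
    | zero => simp [border₂, Literature.LinearAlgebra.Matrix.border, hd]
    | succ j =>
      induction j using Fin.cases with
      | zero => rw [he0, he1]; simp [border₂, Literature.LinearAlgebra.Matrix.border, wN]
      | succ j => rw [he0, hess]; simp [border₂, Literature.LinearAlgebra.Matrix.border, vS, vN]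
  | succ i =>
    induction i using Fin.cases with
    | zero =>
      rw [he1]
      induction j using Fin.cases with
      | zero => rw [he0, halt]; simp [border₂, Literature.LinearAlgebra.Matrix.border, wN]
      | succ j =>
        induction j using Fin.cases with
        | zero => rw [he1, hd]; simp [border₂, Literature.LinearAlgebra.Matrix.border]
        | succ j => rw [hess]; simp [border₂, Literature.LinearAlgebra.Matrix.border, uS, uN]
    | succ i =>
      rw [hess]
      induction j using Fin.cases with
      | zero => rw [he0, halt]; simp [border₂, Literature.LinearAlgebra.Matrix.border, vS, vN]
      | succ j =>
        induction j using Fin.cases with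
        | zero => rw [he1, halt]; simp [border₂, Literature.LinearAlgebra.Matrix.border, uS, uN]
        | succ j => rw [hess]; simp [border₂, Literature.LinearAlgebra.Matrix.border]

end Structure

/-! ## §2 Rote's recursion for the trailing blocks, and the closed forms of the walk sums -/

section Recursion

variable {t} {A}

/-- Rote's recursion (23) for the trailing blocks of `A`, coefficients `≥ 2`
(`PfaffianSamuelson.coeff_pfaffian_pencil_border₂` on the tower `blk_eq_border₂`, `stdJ_eq_border₂`).
[cite: Rote2001, §3.3 (23)] -/
theorem q_coeff_step (hA : Aᵀ = -A) (hd : ∀ i, A i i = 0) (m : ℕ) (hm : m + 4 ≤ 2 * t + 2)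
    (hev : Even m) (d : ℕ) :
    (q t A (m + 4)).coeff (d + 2) = (q t A (m + 2)).coeff (d + 2) +
      wN t A (m + 2) * (q t A (m + 2)).coeff (d + 1) -
      ∑ b ∈ Finset.range (d + 1), (q t A (m + 2)).coeff (d - b) * rS t A (m + 2) b := by
  have hev2 : Even (m + 2) := by obtain ⟨k, hk⟩ := hev; exact ⟨k + 1, by omega⟩
  unfold q rS K
  rw [blk_eq_border₂ hA hd m hm, stdJ_eq_border₂]
  exact coeff_pfaffian_pencil_border₂ (blk t A (m + 2)) (stdJ (m + 2)) (blk_transpose hA _)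
    (blk_apply_self hd _) (stdJ_transpose _) (stdJ_apply_self _) (stdJ_mul_stdJ hev2) _ _ _ d

/-- Rote's recursion (23) for the trailing blocks, coefficients `0` and `1`. [cite: Rote2001, §3.3 (23)] -/
theorem q_coeff_step_zero_one (hA : Aᵀ = -A) (hd : ∀ i, A i i = 0) (m : ℕ) (hm : m + 4 ≤ 2 * t + 2) :
    (q t A (m + 4)).coeff 0 = (q t A (m + 2)).coeff 0 ∧
      (q t A (m + 4)).coeff 1 = (q t A (m + 2)).coeff 1 + wN t A (m + 2) * (q t A (m + 2)).coeff 0 := by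
  unfold q
  rw [blk_eq_border₂ hA hd m hm, stdJ_eq_border₂]
  exact coeff_pfaffian_pencil_border₂_zero_one _ _ _ _ _

/-- `q_0 = 1` (the empty Pfaffian). [cite: Rote2001, §3.3 (23)] -/
private theorem q_zero : q t A 0 = 1 := by
  simp [q]

/-- `q_2 = X·w + 1` (the `2 × 2` base of the tower). [cite: Rote2001, §3.3 (23)] -/
private theorem q_two : q t A 2 = X * C (wN t A 0) + 1 := by
  unfold q
  rw [pfaffian_pencil_fin_two _ _ (by simp [stdJ])]
  have h0 : emb t 2 ((0 : Fin 2) : ℕ) = prow t 0 := Fin.ext (by simp only [emb, prow, Fin.val_zero]; omega)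
  have h1 : emb t 2 ((1 : Fin 2) : ℕ) = prow' t 0 := Fin.ext (by simp only [emb, prow', Fin.val_one]; omega)
  simp only [blk, submatrix_apply, h0, h1, wN]

/-- `valPos` agrees with its closed form on the positions of the block. [folklore] -/
private theorem valPos_eq_G (n : ℕ) : ∀ (d : ℕ) (x : Fin n), valPos t A n d x = G t A n d x
  | 0, x => by simp [valPos, G]
  | d + 1, x' => by
    have hK : ∑ x ∈ Finset.range n, valPos t A n d x * KN t A n x x' =
        ∑ x : Fin n, G t A n d x * K t A n x x' := by
      rw [← Fin.sum_univ_eq_sum_range]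
      refine Finset.sum_congr rfl fun x _ => ?_
      rw [valPos_eq_G n d x, KN, dif_pos ⟨x.isLt, x'.isLt⟩]
    have hstep : ∀ b ∈ Finset.range d,
        (q t A n).coeff (d - (b + 1)) * (vS t A n ᵥ* K t A n ^ (b + 1)) x' =
          ∑ x : Fin n, (q t A n).coeff (d - 1 - b) * (vS t A n ᵥ* K t A n ^ b) x * K t A n x x' := by
      intro b hb
      rw [Finset.mem_range] at hb
      rw [pow_succ, ← vecMul_vecMul, vecMul, dotProduct, Finset.mul_sum,
        show d - (b + 1) = d - 1 - b by omega]
      refine Finset.sum_congr rfl fun x _ => ?_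
      ring
    rw [valPos, hK]
    simp only [G, Finset.sum_range_succ' _ d, pow_zero, vecMul_one, Nat.add_sub_cancel, Nat.sub_zero,
      Finset.sum_congr rfl hstep, neg_mul, Finset.sum_neg_distrib, Finset.sum_mul, neg_add]
    rw [Finset.sum_comm]
    simp only [vS, vN]
    ring

/-- Closed form of the `†`-value: `w · q_{n,d} − Σ_{b<d} q_{n,d−1−b} · r_{n,b}`. [folklore] -/
private theorem valDag_succ (n d : ℕ) :
    valDag t A n (d + 1) = wN t A n * (q t A n).coeff d -
      ∑ b ∈ Finset.range d, (q t A n).coeff (d - 1 - b) * rS t A n b := by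
  rw [valDag, sub_eq_add_neg]
  congr 1
  rw [← Fin.sum_univ_eq_sum_range]
  have h1 : ∀ x : Fin n, valPos t A n d x * cN t A n x =
      G t A n d x * ((stdJ n : Matrix (Fin n) (Fin n) S) *ᵥ uS t A n) x := fun x => by
    rw [valPos_eq_G, cN, dif_pos x.isLt]
  simp only [h1, G, neg_mul, Finset.sum_neg_distrib, Finset.sum_mul]
  rw [Finset.sum_comm]
  congr 1
  refine Finset.sum_congr rfl fun b _ => ?_
  rw [rS, ← mulVec_mulVec, dotProduct_mulVec, dotProduct, Finset.mul_sum]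
  refine Finset.sum_congr rfl fun x _ => ?_
  ring

/-- **The `⋆`-step of the program** (Rote's recursion (23), all coefficients): for even `m` with
`m + 4 ≤ 2t + 2`, `q_{m+4,d} = q_{m+2,d} + valDag_{m+2,d}`. [cite: Rote2001, §3.3 (23)] -/
private theorem q_coeff_eq_add_valDag (hA : Aᵀ = -A) (hd : ∀ i, A i i = 0) (m : ℕ) (hm : m + 4 ≤ 2 * t + 2)
    (hev : Even m) : ∀ d : ℕ, (q t A (m + 4)).coeff d = (q t A (m + 2)).coeff d + valDag t A (m + 2) d
  | 0 => by rw [(q_coeff_step_zero_one hA hd m hm).1, valDag, add_zero]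
  | 1 => by
    rw [(q_coeff_step_zero_one hA hd m hm).2, valDag]
    simp [valPos]
  | d + 2 => by
    rw [q_coeff_step hA hd m hm hev d, valDag_succ, show d + 1 - 1 = d from rfl]
    ring

/-- The `⋆`-step out of the empty block: `q_{2,d} = q_{0,d} + valDag_{0,d}`. [cite: Rote2001, §3.3 (23)] -/
private theorem q_two_coeff_eq_add_valDag : ∀ d : ℕ, (q t A 2).coeff d = (q t A 0).coeff d + valDag t A 0 d
  | 0 => by simp [q_two, q_zero, valDag]
  | 1 => by simp [q_two, q_zero, valDag, add_comm]
  | d + 2 => by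
    rw [q_two, q_zero, valDag, q_zero]
    simp [coeff_one]

end Recursion

/-! ## §3 The layered program and its invariant -/

section Program

/-- Vertices `(d, i, state)`: degree layer `d ≤ t+1`, block index `i ≤ t+1` (block size `2i`), and a
state — `none` = the block's `⋆`-state (carries `q_{2i,d}`), `some none` = its `†`-state (corner edge
and closed walks), `some (some x)` = position `x` of block `i` (meaningful for `x < 2i`). [folklore] -/
abbrev Vtx (t : ℕ) : Type := Fin (t + 2) × Fin (t + 2) × Option (Option (Fin (2 * t + 2)))

/-- The layer of a vertex: `d + i` (every edge raises it by one). [folklore] -/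
def layer (v : Vtx t) : ℕ := (v.1 : ℕ) + (v.2.1 : ℕ)

/-- The source `(0, 0, ⋆)`. [folklore] -/
def src : Vtx t := (0, 0, none)

/-- The sink `(t+1, t+1, ⋆)`. [folklore] -/
def snk : Vtx t := (Fin.last (t + 1), Fin.last (t + 1), none)

/-- The edge labels of the program (all of the form `0`, `1`, `±` an entry of `A`, or a signed sum of
at most one entry of `A`): skip `⋆ → ⋆'` and transfer `† → ⋆'` into the next block (label `1`), the
corner edge `⋆ → †` (label `w`), opening `⋆ → x'` (label `−v_{x'}`), stepping `x → x'` (label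
`K[x,x'] = (J A_n)[x,x']`), closing `x → †` (label `(J u)[x]`), all raising the degree by one.
[folklore] -/
def adj : Matrix (Vtx t) (Vtx t) S := fun u v =>
  match u.2.2, v.2.2 with
  | none, none => if v.1 = u.1 ∧ (v.2.1 : ℕ) = u.2.1 + 1 then 1 else 0
  | some none, none => if v.1 = u.1 ∧ (v.2.1 : ℕ) = u.2.1 + 1 then 1 else 0
  | some (some _), none => 0
  | none, some none => if (v.1 : ℕ) = u.1 + 1 ∧ v.2.1 = u.2.1 then wN t A (2 * u.2.1) else 0
  | some none, some none => 0
  | some (some x), some none =>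
      if (v.1 : ℕ) = u.1 + 1 ∧ v.2.1 = u.2.1 ∧ (x : ℕ) < 2 * u.2.1 then cN t A (2 * u.2.1) x else 0
  | none, some (some x') =>
      if (v.1 : ℕ) = u.1 + 1 ∧ v.2.1 = u.2.1 ∧ (x' : ℕ) < 2 * u.2.1 then -vN t A (2 * u.2.1) x' else 0
  | some none, some (some _) => 0
  | some (some x), some (some x') =>
      if (v.1 : ℕ) = u.1 + 1 ∧ v.2.1 = u.2.1 ∧ (x : ℕ) < 2 * u.2.1 ∧ (x' : ℕ) < 2 * u.2.1
      then KN t A (2 * u.2.1) x x' else 0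

/-- The intended values of the vertices (sums over source paths). [folklore] -/
def val : Vtx t → S
  | (d, i, none) => (q t A (2 * i)).coeff d
  | (d, i, some none) => valDag t A (2 * i) d
  | (d, i, some (some x)) => if (x : ℕ) < 2 * i then valPos t A (2 * i) d x else 0

variable {t} {A}

/-- Every edge raises the layer by one. [folklore] -/
private theorem layer_eq_of_adj_ne_zero {u v : Vtx t} (h : adj t A u v ≠ 0) : layer t v = layer t u + 1 := by
  obtain ⟨d, i, o⟩ := u
  obtain ⟨d', i', o'⟩ := v
  simp only [layer]
  rcases o with _ | _ | x <;> rcases o' with _ | _ | x' <;> simp only [adj] at h <;>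
    first
    | exact absurd rfl h
    | (split_ifs at h with hc
       · simp only [Fin.ext_iff] at hc; omega
       · exact absurd rfl h)

/-- Bookkeeping: a double sum supported on the predecessor layer `d = d' − 1`, same block. [folklore] -/
private theorem sum_sum_ite_pred (d' i' : Fin (t + 2)) (g : Fin (t + 2) → Fin (t + 2) → S) :
    ∑ d : Fin (t + 2), ∑ i : Fin (t + 2), (if (d' : ℕ) = d + 1 ∧ i' = i then g d i else 0) =
      if h : (d' : ℕ) = 0 then 0 else g ⟨d' - 1, by omega⟩ i' := by
  by_cases h : (d' : ℕ) = 0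
  · rw [dif_pos h]
    refine Finset.sum_eq_zero fun d _ => Finset.sum_eq_zero fun i _ => ?_
    rw [if_neg]; omega
  · rw [dif_neg h, Finset.sum_eq_single ⟨d' - 1, by omega⟩]
    · have hc : (((⟨(d' : ℕ) - 1, by omega⟩ : Fin (t + 2)) : ℕ) + 1) = d' := by simp; omega
      simp only [hc, true_and]
      rw [Finset.sum_ite_eq]; simp
    · intro d _ hne
      refine Finset.sum_eq_zero fun i _ => ?_
      rw [if_neg]
      rintro ⟨h1, -⟩
      exact hne (Fin.ext (by simp; omega))
    · intro hh; exact absurd (Finset.mem_univ _) hh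

/-- Bookkeeping: a double sum supported on the same layer `d = d'`, previous block `i = i' − 1`. [folklore] -/
private theorem sum_sum_ite_succ (d' i' : Fin (t + 2)) (g : Fin (t + 2) → Fin (t + 2) → S) :
    ∑ d : Fin (t + 2), ∑ i : Fin (t + 2), (if d' = d ∧ (i' : ℕ) = i + 1 then g d i else 0) =
      if h : (i' : ℕ) = 0 then 0 else g d' ⟨i' - 1, by omega⟩ := by
  by_cases h : (i' : ℕ) = 0
  · rw [dif_pos h]
    refine Finset.sum_eq_zero fun d _ => Finset.sum_eq_zero fun i _ => ?_
    rw [if_neg]; omega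
  · rw [dif_neg h, Finset.sum_eq_single d']
    · rw [Finset.sum_eq_single ⟨i' - 1, by omega⟩]
      · rw [if_pos ⟨rfl, by simp; omega⟩]
      · intro i _ hne
        rw [if_neg]
        rintro ⟨-, h2⟩
        exact hne (Fin.ext (by simp; omega))
      · intro hh; exact absurd (Finset.mem_univ _) hh
    · intro d _ hne
      refine Finset.sum_eq_zero fun i _ => ?_
      rw [if_neg]
      rintro ⟨h1, -⟩
      exact hne h1.symm
    · intro hh; exact absurd (Finset.mem_univ _) hh

/-- Restricting a sum over `Fin (2t+2)` to the positions `x < n` of a block (`n ≤ 2t+2`). [folklore] -/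
private theorem sum_fin_ite_lt {n : ℕ} (hn : n ≤ 2 * t + 2) (f : ℕ → S) :
    ∑ x : Fin (2 * t + 2), (if (x : ℕ) < n then f x else 0) = ∑ x ∈ Finset.range n, f x := by
  rw [Fin.sum_univ_eq_sum_range (fun x => if x < n then f x else 0) (2 * t + 2)]
  have : ∀ x ∈ Finset.range (2 * t + 2), (if x < n then f x else 0) =
      if x ∈ Finset.range n then f x else 0 := fun x _ => by simp only [Finset.mem_range]
  rw [Finset.sum_congr rfl this, Finset.sum_ite_mem, Finset.inter_eq_right.mpr
    (Finset.range_subset_range.mpr hn)]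

/-- **The `⋆`-states satisfy the local recursion** (Rote's (23) at every layer). [cite: Rote2001, §3.3 (23)] -/
private theorem sum_val_adj_star (hA : Aᵀ = -A) (hd : ∀ i, A i i = 0) (d' i' : Fin (t + 2))
    (hl : layer t (d', i', none) ≠ 0) :
    ∑ u, val t A u * adj t A u (d', i', none) = val t A (d', i', none) := by
  have hsum : ∑ u, val t A u * adj t A u (d', i', none) =
      ∑ d : Fin (t + 2), ∑ i : Fin (t + 2), (if d' = d ∧ (i' : ℕ) = i + 1 then
        ((q t A (2 * i)).coeff d + valDag t A (2 * i) d) else 0) := by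
    simp only [Fintype.sum_prod_type, Fintype.sum_option, adj, val, mul_ite, mul_one, mul_zero,
      Finset.sum_const_zero, add_zero, ite_add_ite]
  rw [hsum, sum_sum_ite_succ]
  simp only [layer] at hl
  by_cases h0 : (i' : ℕ) = 0
  · rw [dif_pos h0]
    simp only [val]
    rw [h0, mul_zero, q_zero, coeff_one, if_neg (by omega)]
  · rw [dif_neg h0]
    simp only [val]
    obtain ⟨k, hk⟩ : ∃ k, (i' : ℕ) = k + 1 := ⟨i' - 1, by omega⟩
    have hkt : k ≤ t := by have := i'.isLt; omega
    simp only [hk, Nat.add_sub_cancel]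
    rcases k with _ | k
    · exact (q_two_coeff_eq_add_valDag (t := t) (A := A) d').symm
    · rw [show 2 * (k + 1 + 1) = 2 * k + 4 by ring, show 2 * (k + 1) = 2 * k + 2 by ring]
      exact (q_coeff_eq_add_valDag hA hd (2 * k) (by omega) ⟨k, by ring⟩ d').symm

/-- **The `†`-states satisfy the local recursion** (by construction). [folklore] -/
private theorem sum_val_adj_dag (d' i' : Fin (t + 2)) :
    ∑ u, val t A u * adj t A u (d', i', some none) = val t A (d', i', some none) := by
  have hsum : ∑ u, val t A u * adj t A u (d', i', some none) =
      ∑ d : Fin (t + 2), ∑ i : Fin (t + 2), (if (d' : ℕ) = d + 1 ∧ i' = i then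
        ((q t A (2 * i)).coeff d * wN t A (2 * i) +
          ∑ x ∈ Finset.range (2 * i), valPos t A (2 * i) d x * cN t A (2 * i) x) else 0) := by
    simp only [Fintype.sum_prod_type, Fintype.sum_option, adj, val, mul_ite, mul_zero, zero_mul,
      ite_mul, zero_add]
    refine Finset.sum_congr rfl fun d _ => Finset.sum_congr rfl fun i _ => ?_
    by_cases hc : (d' : ℕ) = d + 1 ∧ i' = i
    · have hi2 : 2 * (i : ℕ) ≤ 2 * t + 2 := by have := i.isLt; omega
      simp only [hc, true_and, if_true, and_self]
      rw [← sum_fin_ite_lt hi2]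
      congr 1
      refine Finset.sum_congr rfl fun x _ => ?_
      split_ifs <;> simp_all
    · rw [if_neg hc, if_neg hc, zero_add]
      refine Finset.sum_eq_zero fun x _ => ?_
      split_ifs with h1 h2 <;> simp_all
  rw [hsum, sum_sum_ite_pred]
  by_cases h0 : (d' : ℕ) = 0
  · rw [dif_pos h0]
    simp only [val, h0, valDag]
  · rw [dif_neg h0]
    simp only [val]
    obtain ⟨k, hk⟩ : ∃ k, (d' : ℕ) = k + 1 := ⟨d' - 1, by omega⟩
    simp only [hk, Nat.add_sub_cancel, valDag]
    ring

/-- **The position states satisfy the local recursion** (by construction). [folklore] -/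
private theorem sum_val_adj_pos (d' i' : Fin (t + 2)) (x' : Fin (2 * t + 2)) :
    ∑ u, val t A u * adj t A u (d', i', some (some x')) = val t A (d', i', some (some x')) := by
  have hsum : ∑ u, val t A u * adj t A u (d', i', some (some x')) =
      ∑ d : Fin (t + 2), ∑ i : Fin (t + 2), (if (d' : ℕ) = d + 1 ∧ i' = i then
        (if (x' : ℕ) < 2 * i then
          (-(vN t A (2 * i) x') * (q t A (2 * i)).coeff d +
            ∑ x ∈ Finset.range (2 * i), valPos t A (2 * i) d x * KN t A (2 * i) x x') else 0) else 0) := by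
    simp only [Fintype.sum_prod_type, Fintype.sum_option, adj, val, mul_ite, mul_zero, zero_mul,
      ite_mul, zero_add]
    refine Finset.sum_congr rfl fun d _ => Finset.sum_congr rfl fun i _ => ?_
    by_cases hc : (d' : ℕ) = d + 1 ∧ i' = i
    · have hi2 : 2 * (i : ℕ) ≤ 2 * t + 2 := by have := i.isLt; omega
      by_cases hx : (x' : ℕ) < 2 * i
      · simp only [hc, hx, true_and, and_true, if_true, and_self]
        rw [← sum_fin_ite_lt hi2]
        congr 1
        · ring
        · refine Finset.sum_congr rfl fun x _ => ?_
          split_ifs <;> simp_all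
      · simp only [hc, hx, and_false, if_false, if_true, and_self, zero_add]
        refine Finset.sum_eq_zero fun x _ => ?_
        simp_all
    · rw [if_neg hc, if_neg, zero_add]
      · refine Finset.sum_eq_zero fun x _ => ?_
        split_ifs with h1 h2 <;> simp_all
      · exact fun h => hc ⟨h.1, h.2.1⟩
  rw [hsum, sum_sum_ite_pred, val]
  simp only
  by_cases h0 : (d' : ℕ) = 0
  · rw [dif_pos h0, h0]
    split_ifs <;> rfl
  · rw [dif_neg h0]
    obtain ⟨k, hk⟩ : ∃ k, (d' : ℕ) = k + 1 := ⟨d' - 1, by omega⟩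
    simp only [hk, Nat.add_sub_cancel]
    split_ifs with hx
    · rw [valPos]
    · rfl

/-- The local recursion at every vertex of positive layer. [folklore] -/
private theorem sum_val_adj (hA : Aᵀ = -A) (hd : ∀ i, A i i = 0) (v : Vtx t) (hl : layer t v ≠ 0) :
    ∑ u, val t A u * adj t A u v = val t A v := by
  obtain ⟨d', i', o⟩ := v
  rcases o with _ | _ | x'
  · exact sum_val_adj_star hA hd d' i' hl
  · exact sum_val_adj_dag d' i'
  · exact sum_val_adj_pos d' i' x'

/-- Layer `0` consists of the source (value `q_{0,0} = 1`) and dead states (value `0`). [folklore] -/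
private theorem val_of_layer_eq_zero (v : Vtx t) (hl : layer t v = 0) :
    val t A v = if v = src t then 1 else 0 := by
  obtain ⟨d, i, o⟩ := v
  simp only [layer] at hl
  have hd0 : d = 0 := by rw [Fin.ext_iff, Fin.val_zero]; omega
  have hi0 : i = 0 := by rw [Fin.ext_iff, Fin.val_zero]; omega
  subst hd0; subst hi0
  rcases o with _ | _ | x
  · simp [src, val, q_zero]
  · rw [if_neg (by simp [src])]
    simp [val, valDag]
  · rw [if_neg (by simp [src])]
    simp [val]

/-- **The invariant of the program**: after `L` steps from the source, the path sum at `v` is `val v`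
if `v` lies on layer `L` and `0` otherwise — i.e. the layered graph realises Rote's incremental
recursion (23) block by block (the `⋆`-state of block `2i` at layer `d + i` carries `[X^d] pf(X·A_{2i} + J_{2i})`).
[cite: Rote2001, §3.3 (23)] -/
theorem adj_pow_src (hA : Aᵀ = -A) (hd : ∀ i, A i i = 0) :
    ∀ (L : ℕ) (v : Vtx t), (adj t A ^ L) (src t) v = if layer t v = L then val t A v else 0
  | 0, v => by
    rw [pow_zero, one_apply]
    by_cases hl : layer t v = 0
    · rw [if_pos hl, val_of_layer_eq_zero v hl]
      simp only [eq_comm]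
    · rw [if_neg hl, if_neg]
      rintro rfl
      exact hl (by simp [layer, src])
  | L + 1, v => by
    rw [pow_succ, mul_apply]
    simp only [adj_pow_src hA hd L]
    by_cases hl : layer t v = L + 1
    · rw [if_pos hl, ← sum_val_adj hA hd v (by omega)]
      refine Finset.sum_congr rfl fun u _ => ?_
      by_cases hu : adj t A u v = 0
      · rw [hu, mul_zero, mul_zero]
      · rw [if_pos]
        have := layer_eq_of_adj_ne_zero hu
        omega
    · rw [if_neg hl]
      refine Finset.sum_eq_zero fun u _ => ?_
      by_cases hu : adj t A u v = 0
      · rw [hu, mul_zero]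
      · rw [if_neg, zero_mul]
        intro hL
        have := layer_eq_of_adj_ne_zero hu
        omega

/-- **The program computes the Pfaffian**: the path sum from the source to the sink after `2t + 2`
layers is `q_{2t+2, t+1} = pf(A)`. [cite: MahajanSubramanyaVinay2004, Theorem 12] -/
theorem adj_pow_src_snk (hA : Aᵀ = -A) (hd : ∀ i, A i i = 0) :
    (adj t A ^ (2 * t + 2)) (src t) (snk t) = Literature.LinearAlgebra.Matrix.pfaffian A := by
  rw [adj_pow_src hA hd, if_pos (by simp [layer, snk]; omega), snk, val]
  simp only [Fin.val_last]
  rw [show 2 * (t + 1) = 2 * t + 2 by ring, q,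
    show t + 1 = (2 * t + 2) / 2 by omega, (natDegree_pfaffian_pencil_le_and_coeff _ _).2, blk_self]

end Program

/-! ## §4 Degrees of the labels, the vertex count, and the layered-ABP statement -/

section Degrees

variable {R : Type*} [CommRing R] {ι : Type*} (t : ℕ)
  (A : Matrix (Fin (2 * t + 2)) (Fin (2 * t + 2)) (MvPolynomial ι R))

/-- The entries of `J_n`, read in a polynomial ring, are the constants `0, ±1`. [folklore] -/
private theorem totalDegree_stdJ (n : ℕ) (x z : Fin n) :
    ((stdJ n : Matrix (Fin n) (Fin n) (MvPolynomial ι R)) x z).totalDegree = 0 := by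
  simp only [stdJ, Matrix.of_apply]
  split_ifs
  · exact MvPolynomial.totalDegree_one
  · rw [MvPolynomial.totalDegree_neg]; exact MvPolynomial.totalDegree_one
  · exact MvPolynomial.totalDegree_zero

variable {A}

/-- All edge labels of the program are affine when the entries of `A` are. [folklore] -/
private theorem totalDegree_adj_le (hdeg : ∀ a b, (A a b).totalDegree ≤ 1) (u v : Vtx t) :
    (adj t A u v).totalDegree ≤ 1 := by
  have h0 : (0 : MvPolynomial ι R).totalDegree ≤ 1 := by rw [MvPolynomial.totalDegree_zero]; exact Nat.zero_le _
  have h1 : (1 : MvPolynomial ι R).totalDegree ≤ 1 := by rw [MvPolynomial.totalDegree_one]; exact Nat.zero_le _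
  have hite : ∀ (c : Prop) [Decidable c] (p : MvPolynomial ι R), p.totalDegree ≤ 1 →
      (if c then p else 0).totalDegree ≤ 1 := fun c _ p hp => by split_ifs <;> assumption
  have hK : ∀ n x x', (KN t A n x x').totalDegree ≤ 1 := by
    intro n x x'
    unfold KN
    split_ifs with h
    · rw [K, Matrix.mul_apply]
      refine (MvPolynomial.totalDegree_finsetSum _ _).trans (Finset.sup_le fun z _ => ?_)
      refine (MvPolynomial.totalDegree_mul _ _).trans ?_
      rw [totalDegree_stdJ, zero_add, blk, submatrix_apply]
      exact hdeg _ _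
    · exact h0
  have hc : ∀ n x, (cN t A n x).totalDegree ≤ 1 := by
    intro n x
    unfold cN
    split_ifs with h
    · rw [mulVec, dotProduct]
      refine (MvPolynomial.totalDegree_finsetSum _ _).trans (Finset.sup_le fun z _ => ?_)
      refine (MvPolynomial.totalDegree_mul _ _).trans ?_
      rw [totalDegree_stdJ, zero_add, uS, uN]
      exact hdeg _ _
    · exact h0
  obtain ⟨d, i, o⟩ := u
  obtain ⟨d', i', o'⟩ := v
  rcases o with _ | _ | x <;> rcases o' with _ | _ | x' <;> simp only [adj]
  · exact hite _ _ h1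
  · exact hite _ _ (hdeg _ _)
  · refine hite _ _ ?_; rw [MvPolynomial.totalDegree_neg]; exact hdeg _ _
  · exact hite _ _ h1
  · exact h0
  · exact h0
  · exact h0
  · exact hite _ _ (hc _ _)
  · exact hite _ _ (hK _ _ _)

end Degrees

section Main

variable {R : Type*} [CommRing R] {ι : Type*}

/-- The vertex count `|Vtx t| = 2 (t+2)³`. [folklore] -/
private theorem card_vtx (t : ℕ) : Fintype.card (Vtx t) = 2 * (t + 2) ^ 3 := by
  simp only [Vtx, Fintype.card_prod, Fintype.card_option, Fintype.card_fin]
  ring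

/-- **A layered ABP with `2(t+2)³` vertices for the Pfaffian of an alternating `(2t+2) × (2t+2)`
matrix with affine entries** (the program of §3, re-indexed by `Fin`): the existence statement
`LayeredABPComputes` of Andrews–Forbes 2022, §3.2, for `pf A`. The published `O(n³)`-vertex programs
are the combinatorial ones of Mahajan–Subramanya–Vinay (Thm. 12, via pclow sequences) and Rote (§3.3);
this one is Rote's incremental recursion (23) realised as a layered graph, with the algebraic
correctness proof of `PfaffianSamuelson.lean`. [cite: MahajanSubramanyaVinay2004, Theorem 12] -/
theorem layeredABPComputes_of_alternating (t : ℕ)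
    (A : Matrix (Fin (2 * t + 2)) (Fin (2 * t + 2)) (MvPolynomial ι R)) (hA : Aᵀ = -A)
    (hd : ∀ i, A i i = 0) (hdeg : ∀ a b, (A a b).totalDegree ≤ 1) :
    LayeredABPComputes (2 * (t + 2) ^ 3) (Literature.LinearAlgebra.Matrix.pfaffian A) := by
  classical
  let e : Vtx t ≃ Fin (Fintype.card (Vtx t)) := Fintype.equivFin (Vtx t)
  refine ⟨Fintype.card (Vtx t), (card_vtx t).le, fun a => layer t (e.symm a), e (src t), e (snk t),
    Matrix.reindex e e (adj t A), ?_, ?_, ?_⟩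
  · intro a b hab
    rw [Matrix.reindex_apply, submatrix_apply] at hab
    exact layer_eq_of_adj_ne_zero hab
  · intro a b
    rw [Matrix.reindex_apply, submatrix_apply]
    exact totalDegree_adj_le t hdeg _ _
  · have hpow : ∀ L : ℕ, (Matrix.reindex e e (adj t A)) ^ L = Matrix.reindex e e (adj t A ^ L) := by
      intro L
      rw [← Matrix.coe_reindexAlgEquiv (MvPolynomial ι R) (MvPolynomial ι R) e, map_pow]
    simp only [Matrix.reindex_apply] at hpow
    simp only [Matrix.reindex_apply, hpow, submatrix_apply, Equiv.symm_apply_apply]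
    simp only [layer, snk, src, Fin.val_last, Fin.val_zero, add_zero, Nat.sub_zero]
    rw [show t + 1 + (t + 1) = 2 * t + 2 by ring]
    exact adj_pow_src_snk hA hd

end Main

end PfaffianABP

section Discharge

variable {R : Type*} [CommRing R]

/-- The generic skew-symmetric matrix has zero diagonal (over any commutative ring; the tree's
`PfaffianReduction.skewX_apply_self` is the field case). [cite: AndrewsForbes2022, §2.6] -/
theorem skewX_diag_eq_zero (k : ℕ) (i : Fin k) : skewX R k i i = 0 := by
  simp [skewX]

/-- **The Pfaffian of the generic `2t × 2t` skew-symmetric matrix is computed by a layered algebraic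
branching program with at most `16 t³` vertices** (`t ≥ 1`, every commutative ring of
coefficients) — the input "[MSV04, Thm. 12]: a layered ABP of size `O(t³)` for `Pf_{2t}`" of the
proof of Andrews–Forbes 2022, Cor. 4.5, in the tree's `LayeredABPComputes` form (vertex count
`2(t+1)³ ≤ 16t³`; labels `0`, `1`, `±x_{ij}`). [cite: MahajanSubramanyaVinay2004, Theorem 12] -/
theorem layeredABPComputes_pfaffian (R : Type*) [CommRing R] (t : ℕ) (ht : 1 ≤ t) :
    LayeredABPComputes (16 * t ^ 3) (pfaffian (2 * t) (skewX R (2 * t))) := by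
  obtain ⟨t, rfl⟩ : ∃ t', t = t' + 1 := ⟨t - 1, by omega⟩
  have h := PfaffianABP.layeredABPComputes_of_alternating t (skewX R (2 * t + 2)) (skewX_transpose _)
    (skewX_diag_eq_zero _) (Theorem44.totalDegree_skewX_le _)
  rw [← pfaffian_eq_matrixPfaffian] at h
  have hle : 2 * (t + 2) ^ 3 ≤ 16 * (t + 1) ^ 3 := by
    have h1 : (t + 2) ^ 3 ≤ (2 * (t + 1)) ^ 3 := Nat.pow_le_pow_left (by omega) 3
    have h2 : (2 * (t + 1)) ^ 3 = 8 * (t + 1) ^ 3 := by ring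
    omega
  exact h.mono hle

/-- **Discharge of `AndrewsForbes2022_cor_4_5`** (Andrews–Forbes 2022, Cor. 4.5, characteristic-zero
bullet): the tree's reduction `AndrewsForbes2022_cor_4_5_of_pfaffianABP` (Thm. 4.4 discharged by
cell val-lit t24) fed with the layered Pfaffian program above, `c = 16`.
[cite: AndrewsForbes2022, Cor. 4.5] -/
theorem AndrewsForbes2022_cor_4_5_holds : AndrewsForbes2022_cor_4_5 :=
  AndrewsForbes2022_cor_4_5_of_pfaffianABP (c := 16) fun F _ _ t ht =>
    layeredABPComputes_pfaffian F t ht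

end Discharge

end Literature.Computability.AlgebraicComplexity
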